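/-
COR-CM (cells pub-hodgecm / pub-hodgecm2, stage 2 of the Hodge ladder) — TEAM hCMisogE (coordinator ruling «FINISH AS FAST AS
POSSIBLE» 2026-08-21T18:44:30Z (1); pin-2 BRIEF `HOME/pinning/hcmisog/BRIEF.md` §1 sub-object (I2); lead ACK of the path
HOME/INBOX 2026-08-21T18:46:16Z; writer hcmisog-isog-2 = prover-pub-hodgecm2-hcmisog-isog-2-0, successor of b01 g79 on (I2)).
The INSTANTIATION of b01's determinant skeleton (`Transposition/Item6PinMatchDet.lean`, `Model.hCMisogE_of_det` /
`Model.exists_isogeny_isCMTypeRealisation_baseChange_of_detInvariant`) AT LIU'S OBJECTS: the binder `hCMisogE` of pin-3's END display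
(= pin-2's `hCMisog`, `Transposition/Item6PinMatch.lean`:352, at the `E`-rational pin `A_μ ⊗_{E,ι₁} ℂ`) FOLLOWS from
[Liu 2021] Def. 4.5 (2) AS PRINTED — item6-p1's `Liu2021.Def45.CMDatum` (`Literature/NumberTheory/Automorphic/Liu2021/
Def45AsPrinted.lean`): the RATIONAL CM structure `i_μ : M_μ → End_E(A_μ)_ℚ` and its FIRST BULLET «the determinant of the action
of `i_μ(x)` on the `E`-vector space `Lie_E(A_μ)` equals `η_μ(x)`» with `η_μ` DEFINED (`Def45.eta`) — composed with the two
standard comparison theorems of the cotangent space at the origin: base change along the pin (sub-object (L1b)) and the Hodge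
`(1,0)`-comparison (sub-object (L2), b18's named fact `cotangent_hodge10_comparison`).  Theorems only: no definition, no instance,
no named fact, no `sorry`.  FRAMING: HC_CM is NOT proved.
-/
import Summits.HodgeConjecture.CorCM.B01.Transposition.Item6PinMatchDet
import Literature.NumberTheory.Automorphic.Liu2021.Def45AsPrinted
import Literature.AlgebraicGeometry.HodgeTheory.AbelianVarietyCotangentHodge
import Literature.NumberTheory.ComplexMultiplication.ShimuraTaniyamaHecke
import Literature.AlgebraicGeometry.Motives.BaseChangeAlongInverse
import HarnessLib

/-!
# Item (vi) S2, CM side: `hCMisogE` at [Liu 2021] Def. 4.5 (2) AS PRINTED (TEAM hCMisogE, sub-object (I2) — the instantiation)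

[Liu2021] Def. 4.5 (`FJcycle.tex` ll. 1936–1964), VERBATIM (the part consumed here):
«(1) We denote by `η'_μ : Res_{M'_μ/ℚ} 𝔾_m → Res_{E/ℚ} 𝔾_m` the reciprocity map, and put
 `η_μ := η'_μ ∘ Nm_{M_μ/M'_μ} : Res_{M_μ/ℚ} 𝔾_m → Res_{E/ℚ} 𝔾_m`.  [ll. 1939–1942]
 (2) We define a *CM data for `μ`* to be a quadruple `D_μ = (A_μ, i_μ, λ_μ, r_μ)`, in which  [l. 1944]
 • `A_μ` is an abelian variety over `E`,  [l. 1946]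
 • `i_μ : M_μ → End_E(A_μ)_ℚ` is a CM structure such that  [l. 1948]
   – for every `x ∈ M_μ`, the determinant of the action of `i_μ(x)` on the `E`-vector space `Lie_E(A_μ)` equals `η_μ(x)`, [l. 1950] …»

WHAT THIS FILE PROVES.  For ONE real abelian variety `A / F` over a CM field `F` Galois over `ℚ` (the cells' `E = F`), a
complex embedding `ι₁ : F → ℂ` (the PIN, `Algebra F ℂ := ι₁.toAlgebra`), Liu's value field `M_μ = muAlgValueField F μ` of a
conjugate-symplectic `μ` and a RATIONAL structure `i : M_μ →+* End⁰(A)` with `[M_μ:ℚ] = 2 dim A` («CM structure», l. 1948) and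
the FIRST BULLET typed, as in `Def45.CMDatum.det45`, on the COTANGENT SPACE AT THE ORIGIN `𝔪_e/𝔪_e² = Lie_E(A)^∨` over `F`
(`Motives.AbelianVariety.Cotangent A`, `cotangentMap A f = f^*`; READING I1-R4 of `Def45AsPrinted`: for every presentation
`i(x) = M⁻¹ · (1 ⊗ f)`, `det(f^* | 𝔪_e/𝔪_e²) = M^{dim A} · η_μ(x)` in `F`):

* §1 `Model.exists_isogeny_isCMTypeRealisation_baseChange_of_det45` — `A ⊗_{F,ι₁} ℂ` is ISOGENOUS to an `𝓞_{M_μ}`-realisation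
  ON `H¹` of the induced type `Ψ̃_μ = inducedCMType e_μ (reflexCMType ι₁ Φ_μ id)` (the `∃`-tail of `hCMisogE`), GIVEN
  (a) b18's named fact `cotangent_hodge10_comparison` (binder `hW`) (Hodge `(1,0)` of a complex abelian variety = cotangent space at the origin,
  `End`-equivariantly: Lange–Birkenhake 1992 §1.1 (1.6), Lemma 1.1.22, Thm 1.1.21; Shimura 1998 §2.8, §3.2) and
  (b) the base change of the cotangent space along the pin, as the ONE object-independent Prop binder `hdetBC`
  («`det (u_L)^* = algebraMap K L (det u^*)` for every abelian variety `A/K`, field extension `L/K`, `u ∈ End A`», universe 0) —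
  TOKEN FOR TOKEN the type of b17's kernel theorem `Motives.AbelianVariety.det_cotangentMap_baseChange` (sub-object (L1b) part II,
  Görtz–Wedhorn I (6.6.2)–(6.6.3), Rem. 6.12; 0 named facts), discharged BY NAME (`fun K _ L _ _ A u =>
  AbelianVariety.det_cotangentMap_baseChange L u`) the minute that module is in the tree (hcmisog-lead AMENDMENT 2026-08-21T19:30:58Z).
  Proof = b01's `Model.exists_isogeny_isCMTypeRealisation_baseChange_of_detInvariant` at `φ := (i ⊗ ℚ)_ℂ = endAlgebra.mapRingHom
  (endBaseChange ℂ A) ∘ i`, `δ := det ∘ cotangentMap A`, `η := Def45.eta id ι₁ hμ`, with `hrat` from the normal form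
  `endAlgebra.exists_eq_algebraMap_mul_of` + the first bullet, `hη` = item6-p1's `Def45.apply_eta_eq_finprod_of_coe_eq` (behind it
  tr-prover-1's (N) `ReflexNormInducedType`), `hL2` = b18's `det_restrict_hodgeOneZero_eq_det_cotangentMap` on `A ⊗_F ℂ` followed by
  `hdetBC F ℂ A f`.
* §1 `Model.exists_isogeny_isCMTypeRealisation_baseChange_of_cmDatum` — the same PER OBJECT `X : Def45.CMDatum (AlgHom.id ℚ F) σ hμ hw C`
  of item6-p1's as-printed typing (hcmisog-lead D4): `A := X.A`, `i := X.i`, `hdim := X.finrank_eq`, `hdet45 := X.det45` — no `Obj`,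
  no `Thm418Data`.
* §2 `Model.hCMisogE_of_det45` — the FACE-GUARDED FAMILY form with EXACTLY the type of the binder `hCMisogE` of
  `Model.hc_cm_of_thm418AsPrinted_pinnedE_isog` (pin-3) / `Model.faceSupply_of_thm418AsPrinted_pinned_isog` (pin-2, :352) at the
  `E`-rational pin `Aμ F ι₁ V Φ D_μ := (Aμ₀ F ι₁ V Φ D_μ).baseChange ℂ`, over the CARRIERS `D` (Thm. 4.18 data), `Aμ₀` (Liu's
  «`A_μ` is an abelian variety over `E`», l. 1946), `iμ₀` (Liu's `i_μ`, l. 1948, RATIONAL — decision (α): no integrality)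
  and the BINDERS `hdim` («CM structure», l. 1948), `hdet45` (FIRST BULLET, l. 1950, token for token the field `det45` of
  `Def45.CMDatum` at `A := Aμ₀ … D_μ`, `i := iμ₀ … D_μ`), after the cite-binder `(hW : cotangent_hodge10_comparison)` and the pending-kernel
  binder `hdetBC` (signature order: standard facts, then carriers, then Liu-data readings — hcmisog-lead D5″ + amendment).  At the glue's
  reading `obj : Obj → Def45.CMDatum …` (under the face guard), `Aμ₀ := (·).A`, `iμ₀ := (·).i`, the two data binders are the PROJECTIONS
  `(·).finrank_eq`, `(·).det45` (hcmisog-glue's file).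

READING / STRENGTH.  Nothing printed is altered: `hdet45` IS Def. 4.5 (2)'s first bullet as typed by `Def45AsPrinted` (on `Lie^∨`,
all presentations `M⁻¹ · (1 ⊗ f)`), `η_μ` is Liu's DEFINED `η'_μ ∘ Nm` with `η'_μ` = the reflex type norm (READING I1-R2 there), and
the conclusion is AS PRINTED up to isogeny over `ℂ` (an `𝓞_{M_μ}`-stable model exists in the isogeny class — binder-1's
`exists_isogeny_isCMTypeRealisation_of_det_complexAction`, Shimura 1998 §5.2 / §7.1 Prop. 7).  What remains HYPOTHETICAL in the END
display after this file: the Hodge comparison `hW` (a cited standard theorem, D-0026 debt of (L2)) and `hdetBC` until b17's (L1b) part II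
lands (then ONE name discharges it); the Liu DATA (`Aμ₀`, `iμ₀`, `hdim`, `hdet45`) are inhabited exactly when an object
of `𝒜(μ)` is given ([Liu2021] Prop. 4.6 (1), the display's `hObj`).  NOT claimed: that Liu's `A_μ` is constructed here; that
`cotangent_hodge10_comparison` is proved; that HC_CM is proved.

References: Y. Liu, *Fourier–Jacobi cycles and arithmetic relative trace formula*, Camb. J. Math. 9 (2021) = arXiv:2102.11518
(`FJcycle.tex` md5 6db49a74122d): §4.1 l. 1928, Def. 4.3 (2) l. 1919, Def. 4.5 ll. 1936–1964, Prop. 4.6 (1) l. 1969; G. Shimura,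
*Abelian Varieties with Complex Multiplication and Modular Functions* (1998) §2.8, §3.2, §5.2, §7.1 Prop. 7, §18.5 (18.5b);
H. Lange, Ch. Birkenhake, *Complex Abelian Varieties* (1992) §1.1 (1.6), Lemma 1.1.22, Thm. 1.1.21; U. Görtz, T. Wedhorn,
*Algebraic Geometry I* (2020) (6.6.2)–(6.6.3), Rem. 6.12; D. Mumford, *Abelian Varieties* (1970) §19.
-/

noncomputable section

open scoped TensorProduct

namespace Summit.HodgeConjecture.CorCM.Model

open CategoryTheory NumberField
open Literature.AlgebraicGeometry.Motives
open Literature.AlgebraicGeometry.HodgeTheory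
open Literature.AlgebraicGeometry.ComplexMultiplication
open Literature.NumberTheory.ComplexMultiplication
open Literature.NumberTheory.Automorphic
open Literature.NumberTheory.Automorphic.IdeleClassGroup
open Literature.NumberTheory.Automorphic.PicardCM
open Literature.NumberTheory.Automorphic.Liu2021

/-! ## §1  One object `(A_μ, i_μ)` of Def. 4.5 (2): the CM type of `A_μ ⊗_{E,ι₁} ℂ` up to isogeny -/

section Core

/-- **The base-changed rational structure is presented by base-changed endomorphisms**: if `i(x) = M⁻¹ · (1 ⊗ f)` in
`End⁰(A)` then `(i ⊗ ℂ)(x) = M⁻¹ · (1 ⊗ f_ℂ)` in `End⁰(A ⊗_F ℂ)` (`End⁰ = ℚ ⊗_ℤ End`, functoriality of `f ↦ f_ℂ`).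
[cite: MumfordAV1970, §19 (p. 176)] -/
theorem endAlgebra_mapRingHom_endBaseChange_eq {F : Type} [Field F] [Algebra F ℂ] (A : AbelianVariety F)
    {R : Type*} [Semiring R] (i : R →+* A.endAlgebra) {x : R} {q : ℚ} {f : End A}
    (hx : i x = algebraMap ℚ A.endAlgebra q * AbelianVariety.endAlgebra.of A f) :
    ((AbelianVariety.endAlgebra.mapRingHom (A.endBaseChange ℂ)).toRingHom.comp i) x =
      algebraMap ℚ (A.baseChange ℂ).endAlgebra q *
        AbelianVariety.endAlgebra.of (A.baseChange ℂ) (AbelianVariety.Hom.baseChange ℂ f) := by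
  rw [RingHom.comp_apply, hx, AlgHom.toRingHom_eq_coe, RingHom.coe_coe, map_mul, AlgHom.commutes]
  congr 1
  exact AbelianVariety.endAlgebra.mapRingHom_tmul (A.endBaseChange ℂ) 1 f

/-- **[Liu2021, Def. 4.5 (2)] ⟹ the CM type of `A_μ ⊗_{E,σ} ℂ`, up to isogeny — ONE object.**  `F` a CM field Galois over `ℚ`,
`σ : F → ℂ` the pin (hcmisog-lead D3: σ-parametric; the record takes `σ := ι₁`, package P2′ `σ := conj ∘ ι₁`), `μ` conjugate symplectic with value field `M_μ = muAlgValueField F μ` and CM type `Φ_μ = hμ.cmType`,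
`A / F` an abelian variety with a RATIONAL structure `i : M_μ → End⁰(A)`, `[M_μ:ℚ] = 2 dim A` («`i_μ` is a CM structure»,
l. 1948), and the FIRST BULLET (l. 1950) on the cotangent space at the origin over `F` (READING I1-R4 of `Def45AsPrinted`):
`det(f^* | 𝔪_e/𝔪_e²) = M^{dim A} · η_μ(x)` whenever `i(x) = M⁻¹ · (1 ⊗ f)`.  GIVEN the Hodge comparison `hW` (sub-object (L2)) and the base-change law `hdetBC` for
determinants on cotangent spaces (sub-object (L1b); the type of b17's `det_cotangentMap_baseChange`), the complex abelian variety `A ⊗_{F,σ} ℂ` is ISOGENOUS to `B` carrying `ιB : 𝓞_{M_μ} → End B`, `θB` with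
`IsCMTypeRealisation (inducedCMType e (reflexCMType σ Φ_μ id)) B ιB θB`, for THE inclusion `e = e_μ : K*_μ → M_μ`
(`(e k : ℂ) = σ k`; Def. 4.3 (2) l. 1919, §4.1 l. 1928).  Proof: b01's `exists_isogeny_isCMTypeRealisation_baseChange_of_detInvariant`
at `φ := (i ⊗ ℚ)_ℂ`, `δ := det ∘ (·)^*`, `η := η_μ`; `hη` is `σ ∘ η_μ = ∏_{θ ∈ Ψ̃_μ} θ` (`Def45.apply_eta_eq_finprod_of_coe_eq`,
tr-prover-1's (N)); `hL2` is b18's `det_restrict_hodgeOneZero_eq_det_cotangentMap` on `A ⊗_F ℂ` followed by `hdetBC F ℂ A f` (L1b).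
[cite: Liu2021, Def. 4.5 (1)–(2) (FJcycle.tex ll. 1939–1951), Def. 4.3 (2) (l. 1919) and §4.1 l. 1928]
[cite: Shimura1998, §5.2 (pp. 36–37), §7.1 Prop. 7 (p. 47) and §18.5 (18.5b)]
[cite: LangeBirkenhake1992, §1.1 (1.6), Lemma 1.1.22 and Theorem 1.1.21] [cite: GortzWedhorn2020, (6.6.2)–(6.6.3) and Remark 6.12] -/
theorem exists_isogeny_isCMTypeRealisation_baseChange_of_det45 (hW : cotangent_hodge10_comparison)
    (hdetBC : ∀ (K : Type) [Field K] (L : Type) [Field L] [Algebra K L] (A : AbelianVariety K) (u : A ⟶ A),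
      LinearMap.det (AbelianVariety.cotangentMap (A.baseChange L) (AbelianVariety.Hom.baseChange L u)) =
        algebraMap K L (LinearMap.det (AbelianVariety.cotangentMap A u)))
    {F : Type} [Field F] [NumberField F] [IsCMField F] [IsGalois ℚ F] (σ : F →+* ℂ)
    {μ : IdeleClassGroup F →ₜ* Circle} (hμ : IsConjugateSymplectic F μ)
    (A : AbelianVariety F) (i : muAlgValueField F μ →+* A.endAlgebra)
    (hdim : Module.finrank ℚ (muAlgValueField F μ) = 2 * A.dim)
    (hdet45 : ∀ (x : muAlgValueField F μ) (M : ℕ) (f : End A), M ≠ 0 →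
      i x = algebraMap ℚ A.endAlgebra (M : ℚ)⁻¹ * AbelianVariety.endAlgebra.of A f →
        LinearMap.det (AbelianVariety.cotangentMap A f) = (M : F) ^ A.dim * Def45.eta (AlgHom.id ℚ F) σ hμ x)
    (e : reflexField ℚ F (algValuedIn σ hμ.cmType.1) →+* muAlgValueField F μ)
    (he : ∀ k : reflexField ℚ F (algValuedIn σ hμ.cmType.1), ((e k : muAlgValueField F μ) : ℂ) = σ k) :
    haveI := hμ.numberField_muAlgValueField
    ∃ (B : AbelianVariety ℂ) (g : (letI := σ.toAlgebra; A.baseChange ℂ) ⟶ B), AbelianVariety.IsIsogeny g ∧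
      ∃ (ιB : 𝓞 (muAlgValueField F μ) →+* End B)
        (θB : muAlgValueField F μ →+* Module.End ℂ (complexBetti B.X 1)),
        IsCMTypeRealisation (inducedCMType e (reflexCMType σ hμ.cmType (AlgHom.id ℚ F))) B ιB θB := by
  letI := σ.toAlgebra
  haveI := hμ.numberField_muAlgValueField
  refine exists_isogeny_isCMTypeRealisation_baseChange_of_detInvariant A
    ((AbelianVariety.endAlgebra.mapRingHom (A.endBaseChange ℂ)).toRingHom.comp i) hdim _
    (fun f => LinearMap.det (AbelianVariety.cotangentMap A f)) (Def45.eta (AlgHom.id ℚ F) σ hμ)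
    (fun k _ => ?_) (fun k _ => ?_) (fun f => ?_)
  · obtain ⟨M, f, hM, hkf⟩ := AbelianVariety.endAlgebra.exists_eq_algebraMap_mul_of (i k)
    exact ⟨M, f, hM, endAlgebra_mapRingHom_endBaseChange_eq A i hkf, hdet45 k M f hM hkf⟩
  · have hη := Def45.apply_eta_eq_finprod_of_coe_eq (AlgHom.id ℚ F) σ hμ e he k
    rw [AlgHom.id_apply] at hη
    rw [RingHom.algebraMap_toAlgebra]
    exact hη
  · -- (L2) on the complex side, then (L1b): `det (f_ℂ)^* = σ (det f^*)` on the cotangent spaces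
    rw [hW.det_restrict_hodgeOneZero_eq_det_cotangentMap (A.baseChange ℂ) (AbelianVariety.Hom.baseChange ℂ f),
      hdetBC F ℂ A f]


/-- **[Liu2021, Def. 4.5 (2)] ⟹ the CM type of `A_μ ⊗_{E,σ} ℂ`, up to isogeny — PER OBJECT `D_μ = (A_μ, i_μ, λ_μ, r_μ)` of item6-p1's
as-printed typing `Def45.CMDatum`** (hcmisog-lead D4: no `Obj`, no `Thm418Data`): the previous theorem at `A := X.A`, `i := X.i`,
`hdim := X.finrank_eq` («CM structure», l. 1948), `hdet45 := X.det45` (FIRST BULLET, l. 1950); the ⟨CARRIER⟩ components `X.isCMCharacter`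
(l. 1952), `X.polDR` (ll. 1955–1958) are not used.  Conditional on the Hodge comparison `hW` (L2) and the base-change law `hdetBC` (L1b).  [cite: Liu2021, Def. 4.5 (2) (FJcycle.tex ll. 1944–1951)] [cite: Shimura1998, §5.2 (pp. 36–37) and §7.1 Prop. 7 (p. 47)] -/
theorem exists_isogeny_isCMTypeRealisation_baseChange_of_cmDatum (hW : cotangent_hodge10_comparison)
    (hdetBC : ∀ (K : Type) [Field K] (L : Type) [Field L] [Algebra K L] (A : AbelianVariety K) (u : A ⟶ A),
      LinearMap.det (AbelianVariety.cotangentMap (A.baseChange L) (AbelianVariety.Hom.baseChange L u)) =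
        algebraMap K L (LinearMap.det (AbelianVariety.cotangentMap A u)))
    {F : Type} [Field F] [NumberField F] [IsCMField F] [IsGalois ℚ F] (σ : F →+* ℂ)
    {μ : IdeleClassGroup F →ₜ* Circle} {hμ : IsConjugateSymplectic F μ} {hw : HasWeight F μ 1} {C : Def45.Carriers F μ}
    (X : Def45.CMDatum (AlgHom.id ℚ F) σ hμ hw C)
    (e : reflexField ℚ F (algValuedIn σ hμ.cmType.1) →+* muAlgValueField F μ)
    (he : ∀ k : reflexField ℚ F (algValuedIn σ hμ.cmType.1), ((e k : muAlgValueField F μ) : ℂ) = σ k) :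
    haveI := hμ.numberField_muAlgValueField
    ∃ (B : AbelianVariety ℂ) (g : (letI := σ.toAlgebra; X.A.baseChange ℂ) ⟶ B), AbelianVariety.IsIsogeny g ∧
      ∃ (ιB : 𝓞 (muAlgValueField F μ) →+* End B)
        (θB : muAlgValueField F μ →+* Module.End ℂ (complexBetti B.X 1)),
        IsCMTypeRealisation (inducedCMType e (reflexCMType σ hμ.cmType (AlgHom.id ℚ F))) B ιB θB :=
  exists_isogeny_isCMTypeRealisation_baseChange_of_det45 hW hdetBC σ hμ X.A X.i X.finrank_eq X.det45 e he

end Core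

/-! ## §2  The face-guarded family: EXACTLY the binder `hCMisogE`, from Def. 4.5 (2) data -/

section Family

/-- **`hCMisogE` from [Liu2021] Def. 4.5 (2) AS PRINTED** — the face-guarded family form, with EXACTLY the type of the binder
`hCMisogE` of `Model.hc_cm_of_thm418AsPrinted_pinnedE_isog` / `Model.faceSupply_of_thm418AsPrinted_pinnedE_isog` (= pin-2's
`hCMisog`, `Item6PinMatch.lean`:352, at the `E`-rational pin `(Aμ₀ F ι₁ V Φ D_μ).baseChange ℂ` along `ι₁`).  CARRIERS: `D`
(Thm. 4.18 data), `Aμ₀` («`A_μ` is an abelian variety over `E`», l. 1946), `iμ₀` («`i_μ : M_μ → End_E(A_μ)_ℚ`», l. 1948 — RATIONAL,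
no integrality).  BINDERS, each guarded
`IsGalois ℚ F → 6 ≤ [F:ℚ] → ι₁ ∈ Φ` (lead RULING «AS-PRINTED JUNCTION T1»): `hdim` («is a CM structure»: `[M_μ:ℚ] = 2 dim A_μ`),
`hdet45` (the FIRST BULLET, l. 1950, token for token `Def45.CMDatum.det45` at `A := Aμ₀ … D_μ`, `i := iμ₀ … D_μ`, with Liu's
DEFINED `η_μ = Def45.eta id ι₁ Φ_μ`), preceded by the cite-binder `hW : cotangent_hodge10_comparison` (sub-object (L2)) and the
object-independent base-change law `hdetBC` (sub-object (L1b): verbatim the type of b17's kernel theorem `det_cotangentMap_baseChange`,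
discharged by that one name once its module lands).  At hcmisog-glue's reading `obj : Obj → Def45.CMDatum …` under the face guard,
`Aμ₀ := (·).A`, `iμ₀ := (·).i`: `hdim := (·).finrank_eq`, `hdet45 := (·).det45`.  Proof: §1 face by face (the record pin `σ := ι₁`).  HC_CM is NOT proved; no binder is inhabited here.
[cite: Liu2021, Def. 4.5 (1)–(2) (FJcycle.tex ll. 1939–1951), Def. 4.3 (2) (l. 1919) and §4.1 l. 1928]
[cite: Shimura1998, §5.2 (pp. 36–37) and §7.1 Prop. 7 (p. 47)] [cite: GortzWedhorn2020, (6.6.2)–(6.6.3) and Remark 6.12] -/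
theorem hCMisogE_of_det45 (hW : cotangent_hodge10_comparison)
    (hdetBC : ∀ (K : Type) [Field K] (L : Type) [Field L] [Algebra K L] (A : AbelianVariety K) (u : A ⟶ A),
      LinearMap.det (AbelianVariety.cotangentMap (A.baseChange L) (AbelianVariety.Hom.baseChange L u)) =
        algebraMap K L (LinearMap.det (AbelianVariety.cotangentMap A u)))
    (D : ∀ (F : CMField) (ι₁ : F →+* ℂ) (_ : HermSpace3 F ι₁) (_ : CMType F), Thm418Data (maximalRealSubfield F) F)
    (Aμ₀ : ∀ (F : CMField) (ι₁ : F →+* ℂ) (V : HermSpace3 F ι₁) (Φ : CMType F), (D F ι₁ V Φ).Obj → AbelianVariety F)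
    (iμ₀ : ∀ (F : CMField) (ι₁ : F →+* ℂ) (V : HermSpace3 F ι₁) (Φ : CMType F) (Dμ : (D F ι₁ V Φ).Obj),
      muAlgValueField F (D F ι₁ V Φ).μ →+* (Aμ₀ F ι₁ V Φ Dμ).endAlgebra)
    (hdim : ∀ (F : CMField) [IsGalois ℚ F], 6 ≤ Module.finrank ℚ F → ∀ (Φ : CMType F) (ι₁ : F →+* ℂ), ι₁ ∈ Φ.1 →
      ∀ (V : HermSpace3 F ι₁) (Dμ : (D F ι₁ V Φ).Obj),
        Module.finrank ℚ (muAlgValueField F (D F ι₁ V Φ).μ) = 2 * (Aμ₀ F ι₁ V Φ Dμ).dim)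
    (hdet45 : ∀ (F : CMField) [IsGalois ℚ F], 6 ≤ Module.finrank ℚ F → ∀ (Φ : CMType F) (ι₁ : F →+* ℂ), ι₁ ∈ Φ.1 →
      ∀ (V : HermSpace3 F ι₁) (Dμ : (D F ι₁ V Φ).Obj) (x : muAlgValueField F (D F ι₁ V Φ).μ) (M : ℕ)
        (f : End (Aμ₀ F ι₁ V Φ Dμ)), M ≠ 0 →
        iμ₀ F ι₁ V Φ Dμ x =
          algebraMap ℚ (Aμ₀ F ι₁ V Φ Dμ).endAlgebra (M : ℚ)⁻¹ * AbelianVariety.endAlgebra.of (Aμ₀ F ι₁ V Φ Dμ) f →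
        LinearMap.det (AbelianVariety.cotangentMap (Aμ₀ F ι₁ V Φ Dμ) f) =
          (M : F) ^ (Aμ₀ F ι₁ V Φ Dμ).dim * Def45.eta (AlgHom.id ℚ F) ι₁ (D F ι₁ V Φ).isConjugateSymplectic x) :
    ∀ (F : CMField) [IsGalois ℚ F], 6 ≤ Module.finrank ℚ F → ∀ (Φ : CMType F) (ι₁ : F →+* ℂ), ι₁ ∈ Φ.1 →
      ∀ (V : HermSpace3 F ι₁) (Dμ : (D F ι₁ V Φ).Obj),
        haveI := (D F ι₁ V Φ).isConjugateSymplectic.numberField_muAlgValueField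
        ∀ e : reflexField ℚ F (algValuedIn ι₁ (D F ι₁ V Φ).cmType.1) →+* muAlgValueField F (D F ι₁ V Φ).μ,
          (∀ k : reflexField ℚ F (algValuedIn ι₁ (D F ι₁ V Φ).cmType.1),
            ((e k : muAlgValueField F (D F ι₁ V Φ).μ) : ℂ) = ι₁ k) →
          ∃ (B : AbelianVariety ℂ) (g : (letI := ι₁.toAlgebra; (Aμ₀ F ι₁ V Φ Dμ).baseChange ℂ) ⟶ B),
            AbelianVariety.IsIsogeny g ∧
            ∃ (ιB : 𝓞 (muAlgValueField F (D F ι₁ V Φ).μ) →+* End B)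
              (θB : muAlgValueField F (D F ι₁ V Φ).μ →+* Module.End ℂ (complexBetti B.X 1)),
              IsCMTypeRealisation (inducedCMType e (reflexCMType ι₁ (D F ι₁ V Φ).cmType (AlgHom.id ℚ F))) B ιB θB := by
  intro F _ h6 Φ ι₁ hι V Dμ e he
  exact exists_isogeny_isCMTypeRealisation_baseChange_of_det45 hW hdetBC ι₁ (D F ι₁ V Φ).isConjugateSymplectic
    (Aμ₀ F ι₁ V Φ Dμ) (iμ₀ F ι₁ V Φ Dμ) (hdim F h6 Φ ι₁ hι V Dμ) (hdet45 F h6 Φ ι₁ hι V Dμ) e he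

end Family

end Summit.HodgeConjecture.CorCM.Model

end
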